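/-
Copyright (c) 2026 the pub-hodgecm-mathlib formalisation cell (harness21).  Prover seat hodgecm-mathlib-F0P2-p02 (g11): road «S3-tree» (architect A-p16 (g30) rulings
A-96 (2) ∕ A-102 (3) ∕ A-105 «CAYLEY SHIFT ON CONJUGACY CLASSES + Δ‴ MATCH», the LIFT `_le_one ↦ _le_two`; END F0P3a-p03 (g15)), 2026-09-01.
-/
import Literature.NumberTheory.Rogawski1990.TypeTwoCayleyShiftCM                     -- ★ F0P2-p06 (g10): `exists_local_coe_eq_moebius`, `coe_endoEmbLocal_eq_moebius`, `isLocalNormPair_of_coe_eq_moebius`, `finGammaTwo_of_coe_eq_moebius`, `moebius_mulVec_of_eigenvector_ring`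
import Literature.NumberTheory.Rogawski1990.FinExplicitTransferFactorCayleyShift       -- ★ p846459 (this seat): `finExplicitDelta_eq_inv_sq_mul_of_log_eq` (`Δ‴(γ_H, x) = q⁻²·Δ‴(u_H, y)` on a shared eigenvector)
import Literature.NumberTheory.Automorphic.MatrixMoebiusShiftInverse                  -- ★ p846466 (this seat): `moebius_neg_moebius` (`ψ ∘ φ = id`), `det_smul_conj_add_smul_one`, `isUnit_det_neg_smul_moebius_add_smul_one`
import HarnessLib

/-!
# The Cayley shift on conjugacy classes: `c ↦ ⟦φ(out c)⟧` is a bijection from the classes matching `γ_H` onto the classes matching its shift `u_H`, and the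
# `Δ‴`-weighted orbital sums REINDEX along it with the factor `q_v⁻²` (Rogawski 1990 §4.9 Prop. 4.9.1; Kottwitz 1986 §3)

Topic `NumberTheory/Rogawski1990`; namespace `Literature.NumberTheory.Rogawski1990`.  THEOREMS ONLY (no definition, no instance, no notation, no named fact, no `sorry`);
kernel lane.  Cell `pub/hodgecm-mathlib` (D-0151), crux H413 = `stmt-HodgeConjecture-24833`; road «S3-tree», the LIFT `_le_one ↦ _le_two` of the partial head
`localTransferAtOne_of_hyperspecialLevel_le_two` (END F0P3a-p03 (g15); architect A-p16 (g30) A-88 (6)(ii), A-96 (2), A-101, A-102 (3), A-105).  Organ (a) «CAYLEY SHIFT ON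
CONJUGACY CLASSES» fused with organ (b) ★ `FinExplicitTransferFactorCayleyShift` into the ONE socket the END applies, (A3) of the census 2026-09-01T19:00Z (F0∕P3a bus).
Seat F0P2-p02 (g11).

THE MATHEMATICS.  `G′_v = U(H′)(L⁺_v)` at a non-split unramified place `v` of the CM field `L` (`w ∣ v`), `φ(M) = ((c+1)•M + (c−1)•1)·((c−1)•M + (c+1)•1)⁻¹` the Cayley∕Möbius shift
with a `σ`-fixed parameter `c` (`= ι_v(ϖ_v)`; ★ α `MatrixMoebiusShift`), `γ_H ∈ H_v` DEEP and `G`-regular with `ι_v(γ_H)`'s denominators invertible, and `u_H` ITS SHIFT: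
`u_H = (φ g, φ u)` componentwise (★ `TypeTwoCayleyShiftCM`: then `ι_v(u_H) = φ(ι_v(γ_H))`, `γ₂(u_H) = φ(γ₂(γ_H))`).  For `x ∈ G′_v` matching `γ_H` (`ι_v(γ_H) ↔ x`) the
shift `y ∈ G′_v`, `y = φ(x)` on matrices, EXISTS (★ `exists_local_coe_eq_moebius`: the denominator condition is a class function, ★ `det_smul_conj_add_smul_one`), matches
`u_H` (★ `isLocalNormPair_of_coe_eq_moebius`), shares the `γ₂`-eigenline of `x` (★ ring eigenvector rule), and `Δ‴_v(γ_H, x) = q⁻²·Δ‴_v(u_H, y)` (★ (b)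
`finExplicitDelta_eq_inv_sq_mul_of_log_eq`, given the depth-sum drop `m(u_H) = m(γ_H) + 2`).  Since `φ` is undone by `ψ = φ_{c+1, −(c−1)}` (★
`moebius_neg_moebius`) and commutes with conjugation (★ α `moebius_conj`), `⟦x⟧ ↦ ⟦y⟧` is a BIJECTION from `{c : γ_H ↔ out c}` onto `{c′ : u_H ↔ out c′}` (§2), and
for any class functions `F, F′` with `F ⟦x⟧ = F′ ⟦y⟧` on shifted pairs (§3, the END's interior-term identity for `(Φ(·, g), Φ(·, g′))` via ★ `UnitaryLevelTwoInteriorRelabel`):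
  **`Σᶠ_c Δ‴_v(γ_H, out c)·F c = q_v⁻² · Σᶠ_{c′} Δ‴_v(u_H, out c′)·F′ c′`**
(both `Δ‴` vanish off the matching classes, ★ `finExplicitDelta_of_not_isLocalNormPair`; representatives are moved by ★ `finExplicitDelta_conj_right_all`).  This is the
`q⁻²·Sᵀ·a(g′)` term of the level-2 coefficient law `a(g) = a(h_g) + q⁻²·Sᵀ·a(g′)` (A-101, A-105).
HONEST LABEL: HC_CM is proved only modulo the 2 remaining named inputs (hLiu418 24832, h413 24833) until rung 0 closes; nothing printed is asserted here; S3
(`stub_N6nsS3id`) stays a print row until the road's END lands.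

* §1 per-pair lemmas on `G′_v`: denominators along a matching class (`isUnit_det_shift_denominators_of_isLocalNormPair`), the shift exists (`exists_shift_of_isLocalNormPair`),
  `Δ‴_v(γ_H, x) = q⁻²·Δ‴_v(u_H, y)` for `y = φ(x)` (`finExplicitDelta_eq_inv_sq_mul_of_coe_eq_moebius`).
* §2 the class map `⟦x⟧ ↦ ⟦φ x⟧`: injective (`isConj_of_isConj_shift`), surjective (`exists_isLocalNormPair_coe_eq_moebius_of_isLocalNormPair_shift`), well defined
  (`isConj_shift_of_isConj`), matching is a class function (`isLocalNormPair_of_isConj`).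
* §3 HEAD **`finsum_finExplicitDelta_mul_eq_inv_sq_mul_finsum_shift`** (arbitrary class functions `F, F′` agreeing on shifted pairs) + the letter dress
  `finsum_finExplicitCollection_Δ_mul_eq_inv_sq_mul_finsum_shift` (END's `((finExplicitCollection L H′ μ …) v).Δ`, factor `(((#k(v) : ℕ) : ℂ) ^ 2)⁻¹`).

## References
* [Rogawski1990] J. D. Rogawski, *Automorphic Representations of Unitary Groups in Three Variables*, Ann. of Math. Stud. 123 (1990), §4.9 Prop. 4.9.1 (a)(b) p. 55; §4.3
  (4.3.1)–(4.3.2) p. 43; §14.1 p. 232.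
* [Kottwitz1986] R. E. Kottwitz, *Base change for unit elements of Hecke algebras*, Compositio Math. 60 (1986), §3 (the shift on fixed lattices).
* [LanglandsShelstad1987] R. P. Langlands, D. Shelstad, *On the definition of transfer factors*, Math. Ann. 278 (1987), §1.3–1.4.
-/

set_option autoImplicit false

noncomputable section

open NumberField IsDedekindDomain Matrix Polynomial
open scoped MatrixGroups WithZero

namespace Literature.NumberTheory.Rogawski1990

open Literature.NumberTheory.Automorphic Literature.NumberTheory.Automorphic.UnitaryGroup Literature.NumberTheory.Automorphic.MoebiusShift
open Literature.NumberTheory.GaloisRepresentations Literature.NumberTheory.NumberFields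

variable (L : Type) [Field L] [NumberField L] [IsCMField L] (v : HeightOneSpectrum (𝓞 ↥(maximalRealSubfield L)))
  (H' : Matrix (Fin 3) (Fin 3) L) (w : PlacesOver L v) (hw : IsCMField.complexConj L • w.1 = w.1) (c : LocalRing L v)
  (γH uH : (cmDatum L 2 (Matrix.of fun i j : Fin 2 => if i.val + j.val + 1 = 2 then (1 : L) else 0)).Local v ×
      (cmDatum L 1 (Matrix.of fun i j : Fin 1 => if i.val + j.val + 1 = 1 then (1 : L) else 0)).Local v)

/-! ## §1 Per-pair lemmas: denominators along a matching class, the shift exists, `Δ‴` under the shift -/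

/-- **The denominator determinants are CLASS FUNCTIONS**: for `x` matching `γ_H` (`ι_v(γ_H) ↔ x`, conjugate in `GL₃(E_v)`), `det((c−1)•x + (c+1)•1)` and
`det((c+1)•x + (c−1)•1)` are units as soon as they are at `ι_v(γ_H)` (★ `det_smul_conj_add_smul_one`). [cite: Rogawski1990, §14.1 p. 232] [cite: Kottwitz1986, §3] -/
theorem isUnit_det_shift_denominators_of_isLocalNormPair
    (hD : IsUnit ((c - 1) • (((endoEmbLocal L v γH).val : GL (Fin 3) (LocalRing L v)).val : Matrix (Fin 3) (Fin 3) (LocalRing L v)) +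
      (c + 1) • (1 : Matrix (Fin 3) (Fin 3) (LocalRing L v))).det)
    (hN : IsUnit ((c + 1) • (((endoEmbLocal L v γH).val : GL (Fin 3) (LocalRing L v)).val : Matrix (Fin 3) (Fin 3) (LocalRing L v)) +
      (c - 1) • (1 : Matrix (Fin 3) (Fin 3) (LocalRing L v))).det)
    {x : (cmDatum L 3 H').Local v} (hx : IsLocalNormPair L H' v γH x) :
    IsUnit ((c - 1) • ((x.val : GL (Fin 3) (LocalRing L v)).val : Matrix (Fin 3) (Fin 3) (LocalRing L v)) + (c + 1) • (1 : Matrix (Fin 3) (Fin 3) (LocalRing L v))).det ∧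
      IsUnit ((c + 1) • ((x.val : GL (Fin 3) (LocalRing L v)).val : Matrix (Fin 3) (Fin 3) (LocalRing L v)) + (c - 1) • (1 : Matrix (Fin 3) (Fin 3) (LocalRing L v))).det := by
  obtain ⟨P, hP⟩ := isConj_iff.1 hx
  have hxm : ((x.val : GL (Fin 3) (LocalRing L v)).val : Matrix (Fin 3) (Fin 3) (LocalRing L v)) =
      P.val * (((endoEmbLocal L v γH).val : GL (Fin 3) (LocalRing L v)).val : Matrix (Fin 3) (Fin 3) (LocalRing L v)) * P.val⁻¹ := by
    rw [← hP, Units.val_mul, Units.val_mul, Matrix.coe_units_inv]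
    rfl
  rw [hxm, det_smul_conj_add_smul_one _ _ (Matrix.isUnits_det_units P), det_smul_conj_add_smul_one _ _ (Matrix.isUnits_det_units P)]
  exact ⟨hD, hN⟩

/-- **THE SHIFT OF A MATCHING ELEMENT EXISTS**: for `c` fixed by `σ_v` and `x` matching `γ_H` there is `y ∈ G′_v` with matrix `φ(x)` (★ `exists_local_coe_eq_moebius`; the
denominators by the class-function lemma). [cite: Kottwitz1986, §3] [cite: Rogawski1990, §4.9 Prop. 4.9.1 (b) p. 55] -/
theorem exists_shift_of_isLocalNormPair (hσc : conjLocal L (IsCMField.complexConj L) v c = c)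
    (hD : IsUnit ((c - 1) • (((endoEmbLocal L v γH).val : GL (Fin 3) (LocalRing L v)).val : Matrix (Fin 3) (Fin 3) (LocalRing L v)) +
      (c + 1) • (1 : Matrix (Fin 3) (Fin 3) (LocalRing L v))).det)
    (hN : IsUnit ((c + 1) • (((endoEmbLocal L v γH).val : GL (Fin 3) (LocalRing L v)).val : Matrix (Fin 3) (Fin 3) (LocalRing L v)) +
      (c - 1) • (1 : Matrix (Fin 3) (Fin 3) (LocalRing L v))).det)
    {x : (cmDatum L 3 H').Local v} (hx : IsLocalNormPair L H' v γH x) :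
    ∃ y : (cmDatum L 3 H').Local v, ((y.val : GL (Fin 3) (LocalRing L v)).val : Matrix (Fin 3) (Fin 3) (LocalRing L v)) =
      ((c + 1) • ((x.val : GL (Fin 3) (LocalRing L v)).val : Matrix (Fin 3) (Fin 3) (LocalRing L v)) + (c - 1) • 1) *
        ((c - 1) • ((x.val : GL (Fin 3) (LocalRing L v)).val : Matrix (Fin 3) (Fin 3) (LocalRing L v)) + (c + 1) • 1)⁻¹ := by
  obtain ⟨hDx, hNx⟩ := isUnit_det_shift_denominators_of_isLocalNormPair L v H' c γH hD hN hx
  exact exists_local_coe_eq_moebius L v 3 H' x hσc hDx hNx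

include hw in
open scoped Classical in
/-- **`Δ‴_v(γ_H, x) = q⁻²·Δ‴_v(u_H, y)` FOR THE SHIFTED PAIR `y = φ(x)`** (`u_H = (φ g, φ u)` componentwise, both `G`-regular, depth sum dropping by two; unramified
non-split `v`, `μ` unramified at `w` with the N7 guard): the `γ₂(γ_H)`-eigenvector of `x` (it exists: ★ `exists_eigenvector_of_finKappaAt_ne_zero`, `κ ≠ 0` on `G`-regular
matching pairs) is the `γ₂(u_H)`-eigenvector of `y` (★ ring eigenvector rule + ★ `finGammaTwo_of_coe_eq_moebius`), so ★ (b) `finExplicitDelta_eq_inv_sq_mul_of_log_eq`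
applies; `u_H ↔ y` by ★ `isLocalNormPair_of_coe_eq_moebius`. [cite: Rogawski1990, §4.9 Prop. 4.9.1 (a)(b) p. 55; §4.3 (4.3.2) p. 43] [cite: Kottwitz1986, §3] -/
theorem finExplicitDelta_eq_inv_sq_mul_of_coe_eq_moebius (μ : HeckeCharacter L)
    (hμω : ∀ x : ideleGroup ↥(maximalRealSubfield L), μ (AdeleRing.ideleBaseChange ↥(maximalRealSubfield L) L x) = quadraticHeckeCharCM L x)
    (hunr : Algebra.IsUnramifiedIn (𝓞 L) v.asIdeal) (hμ : μ.IsUnramifiedAt w.1)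
    (hreg : IsLocalGRegular L v γH) (hreg' : IsLocalGRegular L v uH)
    (h1 : ((uH.1.val : GL (Fin 2) (LocalRing L v)).val : Matrix (Fin 2) (Fin 2) (LocalRing L v)) =
      ((c + 1) • ((γH.1.val : GL (Fin 2) (LocalRing L v)).val : Matrix (Fin 2) (Fin 2) (LocalRing L v)) + (c - 1) • 1) *
        ((c - 1) • ((γH.1.val : GL (Fin 2) (LocalRing L v)).val : Matrix (Fin 2) (Fin 2) (LocalRing L v)) + (c + 1) • 1)⁻¹)
    (h2 : ((uH.2.val : GL (Fin 1) (LocalRing L v)).val : Matrix (Fin 1) (Fin 1) (LocalRing L v)) =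
      ((c + 1) • ((γH.2.val : GL (Fin 1) (LocalRing L v)).val : Matrix (Fin 1) (Fin 1) (LocalRing L v)) + (c - 1) • 1) *
        ((c - 1) • ((γH.2.val : GL (Fin 1) (LocalRing L v)).val : Matrix (Fin 1) (Fin 1) (LocalRing L v)) + (c + 1) • 1)⁻¹)
    (hD1 : IsUnit ((c - 1) • ((γH.1.val : GL (Fin 2) (LocalRing L v)).val : Matrix (Fin 2) (Fin 2) (LocalRing L v)) + (c + 1) • (1 : Matrix (Fin 2) (Fin 2) (LocalRing L v))).det)
    (hD2 : IsUnit ((c - 1) • ((γH.2.val : GL (Fin 1) (LocalRing L v)).val : Matrix (Fin 1) (Fin 1) (LocalRing L v)) + (c + 1) • (1 : Matrix (Fin 1) (Fin 1) (LocalRing L v))).det)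
    (hD : IsUnit ((c - 1) • (((endoEmbLocal L v γH).val : GL (Fin 3) (LocalRing L v)).val : Matrix (Fin 3) (Fin 3) (LocalRing L v)) +
      (c + 1) • (1 : Matrix (Fin 3) (Fin 3) (LocalRing L v))).det)
    (hN : IsUnit ((c + 1) • (((endoEmbLocal L v γH).val : GL (Fin 3) (LocalRing L v)).val : Matrix (Fin 3) (Fin 3) (LocalRing L v)) +
      (c - 1) • (1 : Matrix (Fin 3) (Fin 3) (LocalRing L v))).det)
    (hμ₂ : IsUnit ((c - 1) * finGammaTwo L v γH + (c + 1)))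
    (hm : WithZero.log (Valued.v (((finCharpolyTwo L v uH).eval (finGammaTwo L v uH)) w)) =
      WithZero.log (Valued.v (((finCharpolyTwo L v γH).eval (finGammaTwo L v γH)) w)) + 2)
    {x y : (cmDatum L 3 H').Local v} (hx : IsLocalNormPair L H' v γH x)
    (hy : ((y.val : GL (Fin 3) (LocalRing L v)).val : Matrix (Fin 3) (Fin 3) (LocalRing L v)) =
      ((c + 1) • ((x.val : GL (Fin 3) (LocalRing L v)).val : Matrix (Fin 3) (Fin 3) (LocalRing L v)) + (c - 1) • 1) *
        ((c - 1) • ((x.val : GL (Fin 3) (LocalRing L v)).val : Matrix (Fin 3) (Fin 3) (LocalRing L v)) + (c + 1) • 1)⁻¹) :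
    finExplicitDelta L v H' γH μ x = ((Ideal.absNorm v.asIdeal : ℂ) ^ 2)⁻¹ * finExplicitDelta L v H' uH μ y := by
  have hι := coe_endoEmbLocal_eq_moebius L v γH uH c h1 h2 hD1 hD2
  have hy' : IsLocalNormPair L H' v uH y := isLocalNormPair_of_coe_eq_moebius L v H' γH uH x y c hx hι hy hD
  have hu0 : IsUnit ((finCharpolyTwo L v γH).eval (finGammaTwo L v γH)) := isUnit_eval_finCharpolyTwo_of_isLocalGRegular L v γH hreg
  have hu0' : IsUnit ((finCharpolyTwo L v uH).eval (finGammaTwo L v uH)) := isUnit_eval_finCharpolyTwo_of_isLocalGRegular L v uH hreg'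
  obtain ⟨p', hne, hp'⟩ := exists_eigenvector_of_finKappaAt_ne_zero L v H' γH x hx (finKappaAt_ne_zero_of_isUnit L v H' γH x hx hu0)
  obtain ⟨hDx, -⟩ := isUnit_det_shift_denominators_of_isLocalNormPair L v H' c γH hD hN hx
  have hγ₂ := finGammaTwo_of_coe_eq_moebius L v γH uH c h2
  have hp'' : ((y.val.val : Matrix (Fin 3) (Fin 3) (LocalRing L v))) *ᵥ p' = finGammaTwo L v uH • p' := by
    rw [show (y.val.val : Matrix (Fin 3) (Fin 3) (LocalRing L v)) = ((y.val : GL (Fin 3) (LocalRing L v)).val : Matrix (Fin 3) (Fin 3) (LocalRing L v)) from rfl, hy, hγ₂,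
      moebius_mulVec_of_eigenvector_ring hp' hμ₂ hDx]
  exact finExplicitDelta_eq_inv_sq_mul_of_log_eq L v H' w hw μ hμω hunr hμ hx hy' hu0 hu0' hne hp' hp'' hm

/-! ## §2 The class map `⟦x⟧ ↦ ⟦φ x⟧`: injective and surjective between the matching classes -/

/-- **INJECTIVE**: if `y₁ = φ(x₁)`, `y₂ = φ(x₂)` (as matrices, `xᵢ` matching `γ_H`) and `y₁`, `y₂` are conjugate in `G′_v`, then so are `x₁`, `x₂` — conjugate `φ(x₁)` by the
same element (★ α `moebius_conj`) and undo `φ` by `ψ = φ_{c+1,−(c−1)}` (★ `moebius_neg_moebius`; needs `(c+1)² − (c−1)² = 4c` a unit of `E_v`).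
[cite: Kottwitz1986, §3] [cite: Rogawski1990, §4.9 Prop. 4.9.1 (b) p. 55] -/
theorem isConj_of_isConj_shift (h4c : IsUnit ((c + 1) ^ 2 - (c - 1) ^ 2))
    (hD : IsUnit ((c - 1) • (((endoEmbLocal L v γH).val : GL (Fin 3) (LocalRing L v)).val : Matrix (Fin 3) (Fin 3) (LocalRing L v)) +
      (c + 1) • (1 : Matrix (Fin 3) (Fin 3) (LocalRing L v))).det)
    (hN : IsUnit ((c + 1) • (((endoEmbLocal L v γH).val : GL (Fin 3) (LocalRing L v)).val : Matrix (Fin 3) (Fin 3) (LocalRing L v)) +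
      (c - 1) • (1 : Matrix (Fin 3) (Fin 3) (LocalRing L v))).det)
    {x₁ x₂ y₁ y₂ : (cmDatum L 3 H').Local v} (hx₁ : IsLocalNormPair L H' v γH x₁) (hx₂ : IsLocalNormPair L H' v γH x₂)
    (hy₁ : ((y₁.val : GL (Fin 3) (LocalRing L v)).val : Matrix (Fin 3) (Fin 3) (LocalRing L v)) =
      ((c + 1) • ((x₁.val : GL (Fin 3) (LocalRing L v)).val : Matrix (Fin 3) (Fin 3) (LocalRing L v)) + (c - 1) • 1) *
        ((c - 1) • ((x₁.val : GL (Fin 3) (LocalRing L v)).val : Matrix (Fin 3) (Fin 3) (LocalRing L v)) + (c + 1) • 1)⁻¹)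
    (hy₂ : ((y₂.val : GL (Fin 3) (LocalRing L v)).val : Matrix (Fin 3) (Fin 3) (LocalRing L v)) =
      ((c + 1) • ((x₂.val : GL (Fin 3) (LocalRing L v)).val : Matrix (Fin 3) (Fin 3) (LocalRing L v)) + (c - 1) • 1) *
        ((c - 1) • ((x₂.val : GL (Fin 3) (LocalRing L v)).val : Matrix (Fin 3) (Fin 3) (LocalRing L v)) + (c + 1) • 1)⁻¹)
    (hyy : IsConj y₁ y₂) : IsConj x₁ x₂ := by
  obtain ⟨k, hk⟩ := isConj_iff.1 hyy
  refine isConj_iff.2 ⟨k, ?_⟩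
  obtain ⟨hD₁, -⟩ := isUnit_det_shift_denominators_of_isLocalNormPair L v H' c γH hD hN hx₁
  obtain ⟨hD₂, -⟩ := isUnit_det_shift_denominators_of_isLocalNormPair L v H' c γH hD hN hx₂
  -- matrices of the conjugates
  have hkP : IsUnit ((k.val : GL (Fin 3) (LocalRing L v)).val : Matrix (Fin 3) (Fin 3) (LocalRing L v)).det := Matrix.isUnits_det_units _
  have hcoex : (k * x₁ * k⁻¹).val = k.val * x₁.val * k.val⁻¹ := rfl
  have hcoey : (k * y₁ * k⁻¹).val = k.val * y₁.val * k.val⁻¹ := rfl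
  have hkx : (((k * x₁ * k⁻¹).val : GL (Fin 3) (LocalRing L v)).val : Matrix (Fin 3) (Fin 3) (LocalRing L v)) =
      (k.val : GL (Fin 3) (LocalRing L v)).val * (x₁.val : GL (Fin 3) (LocalRing L v)).val * ((k.val : GL (Fin 3) (LocalRing L v)).val)⁻¹ := by
    rw [hcoex, Units.val_mul, Units.val_mul, Matrix.coe_units_inv]
  have hky : (((k * y₁ * k⁻¹).val : GL (Fin 3) (LocalRing L v)).val : Matrix (Fin 3) (Fin 3) (LocalRing L v)) =
      (k.val : GL (Fin 3) (LocalRing L v)).val * (y₁.val : GL (Fin 3) (LocalRing L v)).val * ((k.val : GL (Fin 3) (LocalRing L v)).val)⁻¹ := by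
    rw [hcoey, Units.val_mul, Units.val_mul, Matrix.coe_units_inv]
  -- the denominator at `k x₁ k⁻¹`
  have hD₁' : IsUnit ((c - 1) • ((k.val : GL (Fin 3) (LocalRing L v)).val * (x₁.val : GL (Fin 3) (LocalRing L v)).val * ((k.val : GL (Fin 3) (LocalRing L v)).val)⁻¹) +
      (c + 1) • (1 : Matrix (Fin 3) (Fin 3) (LocalRing L v))).det := by
    rw [det_smul_conj_add_smul_one _ _ hkP]; exact hD₁
  -- `φ(k x₁ k⁻¹) = k φ(x₁) k⁻¹ = k y₁ k⁻¹ = y₂ = φ(x₂)`; undo `φ`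
  have key : (k.val : GL (Fin 3) (LocalRing L v)).val * (x₁.val : GL (Fin 3) (LocalRing L v)).val * ((k.val : GL (Fin 3) (LocalRing L v)).val)⁻¹ =
      ((x₂.val : GL (Fin 3) (LocalRing L v)).val : Matrix (Fin 3) (Fin 3) (LocalRing L v)) := by
    rw [← moebius_neg_moebius ((k.val : GL (Fin 3) (LocalRing L v)).val * (x₁.val : GL (Fin 3) (LocalRing L v)).val * ((k.val : GL (Fin 3) (LocalRing L v)).val)⁻¹) h4c hD₁',
      ← moebius_neg_moebius ((x₂.val : GL (Fin 3) (LocalRing L v)).val : Matrix (Fin 3) (Fin 3) (LocalRing L v)) h4c hD₂,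
      moebius_conj _ _ hkP _ _ hD₁, ← hy₁, ← hy₂, ← hky, hk]
  apply Subtype.ext
  apply Units.ext
  rw [hkx, key]

/-- **SURJECTIVE**: every `y′` matching `u_H` is the shift of some `x` matching `γ_H` — take `x = ψ(y′)` (a point of `G′_v`: ★ `exists_local_coe_eq_moebius` at `(c+1, −(c−1))`,
denominators units because `y′ ∼ ι_v(u_H) = φ(ι_v(γ_H))` and the `ψ`-denominators of a `φ`-value are `(4c)•D⁻¹`, `(4c)•M·D⁻¹`), then `φ(x) = y′` and `x ∼ ψ(ι_v(u_H)) = ι_v(γ_H)`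
(★ `moebius_neg_moebius` twice, ★ α `moebius_conj`). [cite: Kottwitz1986, §3] [cite: Rogawski1990, §4.9 Prop. 4.9.1 (b) p. 55; §14.1 p. 232] -/
theorem exists_isLocalNormPair_coe_eq_moebius_of_isLocalNormPair_shift (hσc : conjLocal L (IsCMField.complexConj L) v c = c)
    (h4c : IsUnit ((c + 1) ^ 2 - (c - 1) ^ 2))
    (hι : (((endoEmbLocal L v uH).val : GL (Fin 3) (LocalRing L v)).val : Matrix (Fin 3) (Fin 3) (LocalRing L v)) =
      ((c + 1) • (((endoEmbLocal L v γH).val : GL (Fin 3) (LocalRing L v)).val : Matrix (Fin 3) (Fin 3) (LocalRing L v)) + (c - 1) • 1) *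
        ((c - 1) • (((endoEmbLocal L v γH).val : GL (Fin 3) (LocalRing L v)).val : Matrix (Fin 3) (Fin 3) (LocalRing L v)) + (c + 1) • 1)⁻¹)
    (hD : IsUnit ((c - 1) • (((endoEmbLocal L v γH).val : GL (Fin 3) (LocalRing L v)).val : Matrix (Fin 3) (Fin 3) (LocalRing L v)) +
      (c + 1) • (1 : Matrix (Fin 3) (Fin 3) (LocalRing L v))).det)
    {y' : (cmDatum L 3 H').Local v} (hy' : IsLocalNormPair L H' v uH y') :
    ∃ x : (cmDatum L 3 H').Local v, IsLocalNormPair L H' v γH x ∧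
      ((y'.val : GL (Fin 3) (LocalRing L v)).val : Matrix (Fin 3) (Fin 3) (LocalRing L v)) =
        ((c + 1) • ((x.val : GL (Fin 3) (LocalRing L v)).val : Matrix (Fin 3) (Fin 3) (LocalRing L v)) + (c - 1) • 1) *
          ((c - 1) • ((x.val : GL (Fin 3) (LocalRing L v)).val : Matrix (Fin 3) (Fin 3) (LocalRing L v)) + (c + 1) • 1)⁻¹ := by
  -- abbreviations
  set M : Matrix (Fin 3) (Fin 3) (LocalRing L v) := (((endoEmbLocal L v γH).val : GL (Fin 3) (LocalRing L v)).val : Matrix (Fin 3) (Fin 3) (LocalRing L v)) with hM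
  set Y' : Matrix (Fin 3) (Fin 3) (LocalRing L v) := ((y'.val : GL (Fin 3) (LocalRing L v)).val : Matrix (Fin 3) (Fin 3) (LocalRing L v)) with hY'
  have hMdet : IsUnit M.det := Matrix.isUnits_det_units _
  -- the `ψ`-denominators at `φ(M)` are units
  have hψD : IsUnit ((-(c - 1)) • (((c + 1) • M + (c - 1) • 1) * ((c - 1) • M + (c + 1) • 1)⁻¹) + (c + 1) • (1 : Matrix (Fin 3) (Fin 3) (LocalRing L v))).det :=
    isUnit_det_neg_smul_moebius_add_smul_one M h4c hD
  have hψN : IsUnit ((c + 1) • (((c + 1) • M + (c - 1) • 1) * ((c - 1) • M + (c + 1) • 1)⁻¹) + (-(c - 1)) • (1 : Matrix (Fin 3) (Fin 3) (LocalRing L v))).det := by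
    rw [smul_moebius_add_neg_smul_one M (c + 1) (c - 1) hD, Matrix.det_smul, Matrix.det_mul]
    exact (h4c.pow _).mul (hMdet.mul ((Matrix.isUnit_nonsing_inv_det_iff (A := (c - 1) • M + (c + 1) • (1 : Matrix (Fin 3) (Fin 3) (LocalRing L v)))).2 hD))
  -- `y′ = P ι(u_H) P⁻¹ = P φ(M) P⁻¹`
  obtain ⟨P, hP⟩ := isConj_iff.1 hy'
  have hPdet : IsUnit (P.val : Matrix (Fin 3) (Fin 3) (LocalRing L v)).det := Matrix.isUnits_det_units P
  have hYm : Y' = P.val * (((c + 1) • M + (c - 1) • 1) * ((c - 1) • M + (c + 1) • 1)⁻¹) * P.val⁻¹ := by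
    rw [hY', ← hP, Units.val_mul, Units.val_mul, Matrix.coe_units_inv]
    change (P.val : Matrix (Fin 3) (Fin 3) (LocalRing L v)) * (((endoEmbLocal L v uH).val : GL (Fin 3) (LocalRing L v)).val : Matrix (Fin 3) (Fin 3) (LocalRing L v)) * P.val⁻¹ = _
    rw [hι]
  -- hence the `ψ`-denominators at `Y′` are units
  have hψDY : IsUnit ((-(c - 1)) • Y' + (c + 1) • (1 : Matrix (Fin 3) (Fin 3) (LocalRing L v))).det := by
    rw [hYm, det_smul_conj_add_smul_one _ _ hPdet]; exact hψD
  have hψNY : IsUnit ((c + 1) • Y' + (-(c - 1)) • (1 : Matrix (Fin 3) (Fin 3) (LocalRing L v))).det := by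
    rw [hYm, det_smul_conj_add_smul_one _ _ hPdet]; exact hψN
  -- `x := ψ(y′) ∈ G′_v`
  have hσa : conjLocal L (IsCMField.complexConj L) v (c + 1) = c + 1 := by rw [map_add, hσc, map_one]
  have hσb : conjLocal L (IsCMField.complexConj L) v (-(c - 1)) = -(c - 1) := by rw [map_neg, map_sub, hσc, map_one]
  obtain ⟨x, hx⟩ := exists_unitary_coe_eq_moebius (σ := conjLocal L (IsCMField.complexConj L) v) y' hσa hσb hψDY hψNY
  refine ⟨x, ?_, ?_⟩
  · -- `x = ψ(P φ(M) P⁻¹) = P ψ(φ M) P⁻¹ = P M P⁻¹`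
    refine isConj_iff.2 ⟨P, Units.ext ?_⟩
    rw [Units.val_mul, Units.val_mul, Matrix.coe_units_inv]
    change (P.val : Matrix (Fin 3) (Fin 3) (LocalRing L v)) * M * P.val⁻¹ = ((x.val : GL (Fin 3) (LocalRing L v)).val : Matrix (Fin 3) (Fin 3) (LocalRing L v))
    rw [← hY'] at hx
    rw [hx, hYm, moebius_conj _ _ hPdet _ _ hψD, moebius_neg_moebius M h4c hD]
  · -- `φ(x) = φ(ψ(Y′)) = Y′`
    rw [← hY'] at hx
    rw [hx]
    have h4c' : IsUnit ((c + 1) ^ 2 - (-(c - 1)) ^ 2) := by rwa [neg_sq]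
    have key := moebius_neg_moebius Y' h4c' hψDY
    rw [neg_neg] at key
    exact key.symm

/-- **FORWARD: conjugate matching elements have conjugate shifts** — `φ(k x k⁻¹) = k φ(x) k⁻¹` (★ α `moebius_conj`), so the class of the shift depends only on the
class of `x` (the class map is WELL DEFINED). [cite: Kottwitz1986, §3] [cite: Rogawski1990, §4.9 Prop. 4.9.1 (b) p. 55] -/
theorem isConj_shift_of_isConj
    (hD : IsUnit ((c - 1) • (((endoEmbLocal L v γH).val : GL (Fin 3) (LocalRing L v)).val : Matrix (Fin 3) (Fin 3) (LocalRing L v)) +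
      (c + 1) • (1 : Matrix (Fin 3) (Fin 3) (LocalRing L v))).det)
    (hN : IsUnit ((c + 1) • (((endoEmbLocal L v γH).val : GL (Fin 3) (LocalRing L v)).val : Matrix (Fin 3) (Fin 3) (LocalRing L v)) +
      (c - 1) • (1 : Matrix (Fin 3) (Fin 3) (LocalRing L v))).det)
    {x₁ x₂ y₁ y₂ : (cmDatum L 3 H').Local v} (hx₁ : IsLocalNormPair L H' v γH x₁)
    (hy₁ : ((y₁.val : GL (Fin 3) (LocalRing L v)).val : Matrix (Fin 3) (Fin 3) (LocalRing L v)) =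
      ((c + 1) • ((x₁.val : GL (Fin 3) (LocalRing L v)).val : Matrix (Fin 3) (Fin 3) (LocalRing L v)) + (c - 1) • 1) *
        ((c - 1) • ((x₁.val : GL (Fin 3) (LocalRing L v)).val : Matrix (Fin 3) (Fin 3) (LocalRing L v)) + (c + 1) • 1)⁻¹)
    (hy₂ : ((y₂.val : GL (Fin 3) (LocalRing L v)).val : Matrix (Fin 3) (Fin 3) (LocalRing L v)) =
      ((c + 1) • ((x₂.val : GL (Fin 3) (LocalRing L v)).val : Matrix (Fin 3) (Fin 3) (LocalRing L v)) + (c - 1) • 1) *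
        ((c - 1) • ((x₂.val : GL (Fin 3) (LocalRing L v)).val : Matrix (Fin 3) (Fin 3) (LocalRing L v)) + (c + 1) • 1)⁻¹)
    (hxx : IsConj x₁ x₂) : IsConj y₁ y₂ := by
  obtain ⟨k, hk⟩ := isConj_iff.1 hxx
  refine isConj_iff.2 ⟨k, ?_⟩
  obtain ⟨hD₁, -⟩ := isUnit_det_shift_denominators_of_isLocalNormPair L v H' c γH hD hN hx₁
  have hkP : IsUnit ((k.val : GL (Fin 3) (LocalRing L v)).val : Matrix (Fin 3) (Fin 3) (LocalRing L v)).det := Matrix.isUnits_det_units _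
  have hcoex : (k * x₁ * k⁻¹).val = k.val * x₁.val * k.val⁻¹ := rfl
  have hcoey : (k * y₁ * k⁻¹).val = k.val * y₁.val * k.val⁻¹ := rfl
  have hkx : ((x₂.val : GL (Fin 3) (LocalRing L v)).val : Matrix (Fin 3) (Fin 3) (LocalRing L v)) =
      (k.val : GL (Fin 3) (LocalRing L v)).val * (x₁.val : GL (Fin 3) (LocalRing L v)).val * ((k.val : GL (Fin 3) (LocalRing L v)).val)⁻¹ := by
    rw [← hk, hcoex, Units.val_mul, Units.val_mul, Matrix.coe_units_inv]
  apply Subtype.ext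
  apply Units.ext
  rw [hcoey, Units.val_mul, Units.val_mul, Matrix.coe_units_inv, hy₂, hkx, moebius_conj _ _ hkP _ _ hD₁, ← hy₁]

/-- Matching is a class function: `ι_v(γ_H) ↔ b`, `b ∼ b′` ⇒ `ι_v(γ_H) ↔ b′` (★ `isLocalNormPair_conj_right`). [cite: Rogawski1990, §14.1 p. 232; §4.3 p. 43] -/
theorem isLocalNormPair_of_isConj {b b' : (cmDatum L 3 H').Local v} (h : IsLocalNormPair L H' v γH b) (hc : IsConj b b') :
    IsLocalNormPair L H' v γH b' := by
  obtain ⟨k, hk⟩ := isConj_iff.1 hc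
  rw [← hk]
  exact (isLocalNormPair_conj_right L v H' γH b k).2 h

/-! ## §3 HEAD: the `Δ‴`-weighted orbital sums reindex along the class shift, with the factor `q_v⁻²` -/

include hw in
open scoped Classical in
/-- **HEAD (A3) — THE `Δ‴`-WEIGHTED SUM REINDEXES UNDER THE CAYLEY SHIFT WITH THE FACTOR `q_v⁻²`.**  `v` unramified non-split (`w ∣ v`, `σw = w`), `μ`
unramified at `w` restricting to `ω_{L/L⁺}`; `c ∈ E_v` `σ`-fixed with `4c = (c+1)² − (c−1)²` a unit; `γ_H`, `u_H ∈ H_v` both `G`-regular, `u_H = (φ g, φ u)` the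
componentwise shift of `γ_H = (g, u)` (`h1 h2`, denominators `hD1 hD2`), the `3 × 3` denominators of `ι_v(γ_H)` units (`hD hN`), `(c−1)γ₂ + (c+1)` a unit and the
depth sum dropping by two (`hm`).  Then for ANY `F, F′ : {classes of G′_v} → ℂ` with `F ⟦x⟧ = F′ ⟦y⟧` whenever `x` matches `γ_H` and `y = φ(x)` on matrices:
  `Σᶠ_c Δ‴_v(γ_H, out c)·F c = q_v⁻² · Σᶠ_{c′} Δ‴_v(u_H, out c′)·F′ c′`.
Proof: both `Δ‴` vanish off the matching classes (★ `finExplicitDelta_of_not_isLocalNormPair`); on them `c ↦ ⟦φ(out c)⟧` is a bijection onto the classes matching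
`u_H` (§2) along which `Δ‴_v(γ_H, out c) = q⁻²·Δ‴_v(u_H, out c′)` (§1 + ★ `finExplicitDelta_conj_right_all`) and `F c = F′ c′`; `finsum_mem_eq_of_bijOn`.  The END
reads it with `F = Φ(·, g_int)`, `F′ = Φ(·, g′)` (interior organ of `stub_liftInterior`, fold v2 ED.2∕v3; A-101, A-105, A-109).
[cite: Rogawski1990, §4.9 Prop. 4.9.1 (a)(b) p. 55; §4.3 (4.3.1)–(4.3.2) p. 43] [cite: Kottwitz1986, §3] [cite: LanglandsShelstad1987, §1.3] -/
theorem finsum_finExplicitDelta_mul_eq_inv_sq_mul_finsum_shift (μ : HeckeCharacter L)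
    (hμω : ∀ x : ideleGroup ↥(maximalRealSubfield L), μ (AdeleRing.ideleBaseChange ↥(maximalRealSubfield L) L x) = quadraticHeckeCharCM L x)
    (hunr : Algebra.IsUnramifiedIn (𝓞 L) v.asIdeal) (hμ : μ.IsUnramifiedAt w.1)
    (hσc : conjLocal L (IsCMField.complexConj L) v c = c) (h4c : IsUnit ((c + 1) ^ 2 - (c - 1) ^ 2))
    (hreg : IsLocalGRegular L v γH) (hreg' : IsLocalGRegular L v uH)
    (h1 : ((uH.1.val : GL (Fin 2) (LocalRing L v)).val : Matrix (Fin 2) (Fin 2) (LocalRing L v)) =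
      ((c + 1) • ((γH.1.val : GL (Fin 2) (LocalRing L v)).val : Matrix (Fin 2) (Fin 2) (LocalRing L v)) + (c - 1) • 1) *
        ((c - 1) • ((γH.1.val : GL (Fin 2) (LocalRing L v)).val : Matrix (Fin 2) (Fin 2) (LocalRing L v)) + (c + 1) • 1)⁻¹)
    (h2 : ((uH.2.val : GL (Fin 1) (LocalRing L v)).val : Matrix (Fin 1) (Fin 1) (LocalRing L v)) =
      ((c + 1) • ((γH.2.val : GL (Fin 1) (LocalRing L v)).val : Matrix (Fin 1) (Fin 1) (LocalRing L v)) + (c - 1) • 1) *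
        ((c - 1) • ((γH.2.val : GL (Fin 1) (LocalRing L v)).val : Matrix (Fin 1) (Fin 1) (LocalRing L v)) + (c + 1) • 1)⁻¹)
    (hD1 : IsUnit ((c - 1) • ((γH.1.val : GL (Fin 2) (LocalRing L v)).val : Matrix (Fin 2) (Fin 2) (LocalRing L v)) + (c + 1) • (1 : Matrix (Fin 2) (Fin 2) (LocalRing L v))).det)
    (hD2 : IsUnit ((c - 1) • ((γH.2.val : GL (Fin 1) (LocalRing L v)).val : Matrix (Fin 1) (Fin 1) (LocalRing L v)) + (c + 1) • (1 : Matrix (Fin 1) (Fin 1) (LocalRing L v))).det)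
    (hD : IsUnit ((c - 1) • (((endoEmbLocal L v γH).val : GL (Fin 3) (LocalRing L v)).val : Matrix (Fin 3) (Fin 3) (LocalRing L v)) +
      (c + 1) • (1 : Matrix (Fin 3) (Fin 3) (LocalRing L v))).det)
    (hN : IsUnit ((c + 1) • (((endoEmbLocal L v γH).val : GL (Fin 3) (LocalRing L v)).val : Matrix (Fin 3) (Fin 3) (LocalRing L v)) +
      (c - 1) • (1 : Matrix (Fin 3) (Fin 3) (LocalRing L v))).det)
    (hμ₂ : IsUnit ((c - 1) * finGammaTwo L v γH + (c + 1)))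
    (hm : WithZero.log (Valued.v (((finCharpolyTwo L v uH).eval (finGammaTwo L v uH)) w)) =
      WithZero.log (Valued.v (((finCharpolyTwo L v γH).eval (finGammaTwo L v γH)) w)) + 2)
    (F F' : ConjClasses ((cmDatum L 3 H').Local v) → ℂ)
    (hF : ∀ x y : (cmDatum L 3 H').Local v, IsLocalNormPair L H' v γH x →
      ((y.val : GL (Fin 3) (LocalRing L v)).val : Matrix (Fin 3) (Fin 3) (LocalRing L v)) =
        ((c + 1) • ((x.val : GL (Fin 3) (LocalRing L v)).val : Matrix (Fin 3) (Fin 3) (LocalRing L v)) + (c - 1) • 1) *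
          ((c - 1) • ((x.val : GL (Fin 3) (LocalRing L v)).val : Matrix (Fin 3) (Fin 3) (LocalRing L v)) + (c + 1) • 1)⁻¹ →
      F (ConjClasses.mk x) = F' (ConjClasses.mk y)) :
    ∑ᶠ cG : ConjClasses ((cmDatum L 3 H').Local v), finExplicitDelta L v H' γH μ (Quotient.out cG) * F cG =
      ((Ideal.absNorm v.asIdeal : ℂ) ^ 2)⁻¹ *
        ∑ᶠ cG : ConjClasses ((cmDatum L 3 H').Local v), finExplicitDelta L v H' uH μ (Quotient.out cG) * F' cG := by
  have hι := coe_endoEmbLocal_eq_moebius L v γH uH c h1 h2 hD1 hD2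
  -- the shift of a matching element (a choice) and its matrix
  let sh : ∀ x : (cmDatum L 3 H').Local v, IsLocalNormPair L H' v γH x → (cmDatum L 3 H').Local v :=
    fun x hx => Classical.choose (exists_shift_of_isLocalNormPair L v H' c γH hσc hD hN hx)
  have hsh : ∀ (x : (cmDatum L 3 H').Local v) (hx : IsLocalNormPair L H' v γH x),
      (((sh x hx).val : GL (Fin 3) (LocalRing L v)).val : Matrix (Fin 3) (Fin 3) (LocalRing L v)) =
        ((c + 1) • ((x.val : GL (Fin 3) (LocalRing L v)).val : Matrix (Fin 3) (Fin 3) (LocalRing L v)) + (c - 1) • 1) *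
          ((c - 1) • ((x.val : GL (Fin 3) (LocalRing L v)).val : Matrix (Fin 3) (Fin 3) (LocalRing L v)) + (c + 1) • 1)⁻¹ :=
    fun x hx => Classical.choose_spec (exists_shift_of_isLocalNormPair L v H' c γH hσc hD hN hx)
  -- representatives
  have hout : ∀ x : (cmDatum L 3 H').Local v, IsConj x (Quotient.out (ConjClasses.mk x)) := fun x =>
    ConjClasses.mk_eq_mk_iff_isConj.1 (Quotient.out_eq (ConjClasses.mk x)).symm
  have hmk : ∀ cG : ConjClasses ((cmDatum L 3 H').Local v), ConjClasses.mk (Quotient.out cG) = cG := fun cG => Quotient.out_eq cG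
  -- the class map and the two index sets
  let Θ : ConjClasses ((cmDatum L 3 H').Local v) → ConjClasses ((cmDatum L 3 H').Local v) := fun cG =>
    if h : IsLocalNormPair L H' v γH (Quotient.out cG) then ConjClasses.mk (sh _ h) else cG
  have hΘ : ∀ (cG : ConjClasses ((cmDatum L 3 H').Local v)) (h : IsLocalNormPair L H' v γH (Quotient.out cG)), Θ cG = ConjClasses.mk (sh _ h) :=
    fun cG h => dif_pos h
  set S : Set (ConjClasses ((cmDatum L 3 H').Local v)) := {cG | IsLocalNormPair L H' v γH (Quotient.out cG)} with hS
  set S' : Set (ConjClasses ((cmDatum L 3 H').Local v)) := {cG | IsLocalNormPair L H' v uH (Quotient.out cG)} with hS'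
  -- §2: `Θ` is a bijection from `S` onto `S′`
  have hbij : Set.BijOn Θ S S' := by
    refine ⟨fun cG hcG => ?_, fun cG₁ hcG₁ cG₂ hcG₂ hΘeq => ?_, fun cG' hcG' => ?_⟩
    · have h : IsLocalNormPair L H' v γH (Quotient.out cG) := hcG
      show IsLocalNormPair L H' v uH (Quotient.out (Θ cG))
      rw [hΘ cG h]
      exact isLocalNormPair_of_isConj L v H' uH (isLocalNormPair_of_coe_eq_moebius L v H' γH uH _ _ c h hι (hsh _ h) hD) (hout _)
    · have h₁ : IsLocalNormPair L H' v γH (Quotient.out cG₁) := hcG₁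
      have h₂ : IsLocalNormPair L H' v γH (Quotient.out cG₂) := hcG₂
      rw [hΘ cG₁ h₁, hΘ cG₂ h₂, ConjClasses.mk_eq_mk_iff_isConj] at hΘeq
      rw [← hmk cG₁, ← hmk cG₂, ConjClasses.mk_eq_mk_iff_isConj]
      exact isConj_of_isConj_shift L v H' c γH h4c hD hN h₁ h₂ (hsh _ h₁) (hsh _ h₂) hΘeq
    · have h' : IsLocalNormPair L H' v uH (Quotient.out cG') := hcG'
      obtain ⟨x, hx, hxy⟩ := exists_isLocalNormPair_coe_eq_moebius_of_isLocalNormPair_shift L v H' c γH uH hσc h4c hι hD h'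
      have hx' : IsLocalNormPair L H' v γH (Quotient.out (ConjClasses.mk x)) := isLocalNormPair_of_isConj L v H' γH hx (hout x)
      refine ⟨ConjClasses.mk x, hx', ?_⟩
      rw [hΘ _ hx', ← hmk cG', ConjClasses.mk_eq_mk_iff_isConj]
      exact isConj_shift_of_isConj L v H' c γH hD hN hx' (hsh _ hx') hxy (hout x).symm
  -- §1: the summands agree along `Θ`, with the factor `q⁻²`
  have hsummand : ∀ cG ∈ S, finExplicitDelta L v H' γH μ (Quotient.out cG) * F cG =
      ((Ideal.absNorm v.asIdeal : ℂ) ^ 2)⁻¹ * (finExplicitDelta L v H' uH μ (Quotient.out (Θ cG)) * F' (Θ cG)) := by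
    intro cG hcG
    have h : IsLocalNormPair L H' v γH (Quotient.out cG) := hcG
    have hΔ := finExplicitDelta_eq_inv_sq_mul_of_coe_eq_moebius L v H' w hw c γH uH μ hμω hunr hμ hreg hreg' h1 h2 hD1 hD2 hD hN hμ₂ hm h (hsh _ h)
    obtain ⟨k, hk⟩ := isConj_iff.1 (hout (sh _ h))
    have hΔ' : finExplicitDelta L v H' uH μ (Quotient.out (Θ cG)) = finExplicitDelta L v H' uH μ (sh _ h) := by
      rw [hΘ cG h, ← hk]
      exact finExplicitDelta_conj_right_all L H' μ v uH (sh _ h) k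
    have hFF : F cG = F' (Θ cG) := by
      rw [hΘ cG h, ← hF _ _ h (hsh _ h), hmk]
    rw [hΔ', hFF, hΔ, mul_assoc]
  -- both sums live on the matching classes
  have hL : (∑ᶠ cG : ConjClasses ((cmDatum L 3 H').Local v), finExplicitDelta L v H' γH μ (Quotient.out cG) * F cG) =
      ∑ᶠ cG ∈ S, finExplicitDelta L v H' γH μ (Quotient.out cG) * F cG := by
    rw [finsum_mem_def]
    refine finsum_congr fun cG => ?_
    by_cases h : cG ∈ S
    · rw [Set.indicator_of_mem h]
    · have h0 : ¬ IsLocalNormPair L H' v γH (Quotient.out cG) := h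
      rw [Set.indicator_of_notMem h, finExplicitDelta_of_not_isLocalNormPair L v H' γH μ h0, zero_mul]
  have hR : (∑ᶠ cG : ConjClasses ((cmDatum L 3 H').Local v), finExplicitDelta L v H' uH μ (Quotient.out cG) * F' cG) =
      ∑ᶠ cG ∈ S', finExplicitDelta L v H' uH μ (Quotient.out cG) * F' cG := by
    rw [finsum_mem_def]
    refine finsum_congr fun cG => ?_
    by_cases h : cG ∈ S'
    · rw [Set.indicator_of_mem h]
    · have h0 : ¬ IsLocalNormPair L H' v uH (Quotient.out cG) := h
      rw [Set.indicator_of_notMem h, finExplicitDelta_of_not_isLocalNormPair L v H' uH μ h0, zero_mul]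
  rw [hL, hR, mul_finsum_mem]
  exact finsum_mem_eq_of_bijOn Θ hbij hsummand

include hw in
open scoped Classical in
/-- The same in the LETTER SPELLING of the S3-tree heads (END fold v2 ED.2 `stub_liftInterior`, last conjunct):
`Σᶠ_c ((finExplicitCollection L H′ μ …) v).Δ γ_H (out c)·F c = (((#k(v) : ℕ) : ℂ)²)⁻¹ · Σᶠ_{c′} ((finExplicitCollection L H′ μ …) v).Δ u_H (out c′)·F′ c′` (★ `finExplicitCollection_Δ`
is `rfl`). [cite: Rogawski1990, §4.9 Prop. 4.9.1 (a)(b) p. 55; §4.3 (4.3.1) p. 43] [cite: Kottwitz1986, §3] -/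
theorem finsum_finExplicitCollection_Δ_mul_eq_inv_sq_mul_finsum_shift (μ : HeckeCharacter L)
    (hμω : ∀ x : ideleGroup ↥(maximalRealSubfield L), μ (AdeleRing.ideleBaseChange ↥(maximalRealSubfield L) L x) = quadraticHeckeCharCM L x)
    (hunr : Algebra.IsUnramifiedIn (𝓞 L) v.asIdeal) (hμ : μ.IsUnramifiedAt w.1)
    (hσc : conjLocal L (IsCMField.complexConj L) v c = c) (h4c : IsUnit ((c + 1) ^ 2 - (c - 1) ^ 2))
    (hreg : IsLocalGRegular L v γH) (hreg' : IsLocalGRegular L v uH)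
    (h1 : ((uH.1.val : GL (Fin 2) (LocalRing L v)).val : Matrix (Fin 2) (Fin 2) (LocalRing L v)) =
      ((c + 1) • ((γH.1.val : GL (Fin 2) (LocalRing L v)).val : Matrix (Fin 2) (Fin 2) (LocalRing L v)) + (c - 1) • 1) *
        ((c - 1) • ((γH.1.val : GL (Fin 2) (LocalRing L v)).val : Matrix (Fin 2) (Fin 2) (LocalRing L v)) + (c + 1) • 1)⁻¹)
    (h2 : ((uH.2.val : GL (Fin 1) (LocalRing L v)).val : Matrix (Fin 1) (Fin 1) (LocalRing L v)) =
      ((c + 1) • ((γH.2.val : GL (Fin 1) (LocalRing L v)).val : Matrix (Fin 1) (Fin 1) (LocalRing L v)) + (c - 1) • 1) *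
        ((c - 1) • ((γH.2.val : GL (Fin 1) (LocalRing L v)).val : Matrix (Fin 1) (Fin 1) (LocalRing L v)) + (c + 1) • 1)⁻¹)
    (hD1 : IsUnit ((c - 1) • ((γH.1.val : GL (Fin 2) (LocalRing L v)).val : Matrix (Fin 2) (Fin 2) (LocalRing L v)) + (c + 1) • (1 : Matrix (Fin 2) (Fin 2) (LocalRing L v))).det)
    (hD2 : IsUnit ((c - 1) • ((γH.2.val : GL (Fin 1) (LocalRing L v)).val : Matrix (Fin 1) (Fin 1) (LocalRing L v)) + (c + 1) • (1 : Matrix (Fin 1) (Fin 1) (LocalRing L v))).det)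
    (hD : IsUnit ((c - 1) • (((endoEmbLocal L v γH).val : GL (Fin 3) (LocalRing L v)).val : Matrix (Fin 3) (Fin 3) (LocalRing L v)) +
      (c + 1) • (1 : Matrix (Fin 3) (Fin 3) (LocalRing L v))).det)
    (hN : IsUnit ((c + 1) • (((endoEmbLocal L v γH).val : GL (Fin 3) (LocalRing L v)).val : Matrix (Fin 3) (Fin 3) (LocalRing L v)) +
      (c - 1) • (1 : Matrix (Fin 3) (Fin 3) (LocalRing L v))).det)
    (hμ₂ : IsUnit ((c - 1) * finGammaTwo L v γH + (c + 1)))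
    (hm : WithZero.log (Valued.v (((finCharpolyTwo L v uH).eval (finGammaTwo L v uH)) w)) =
      WithZero.log (Valued.v (((finCharpolyTwo L v γH).eval (finGammaTwo L v γH)) w)) + 2)
    (F F' : ConjClasses ((cmDatum L 3 H').Local v) → ℂ)
    (hF : ∀ x y : (cmDatum L 3 H').Local v, IsLocalNormPair L H' v γH x →
      ((y.val : GL (Fin 3) (LocalRing L v)).val : Matrix (Fin 3) (Fin 3) (LocalRing L v)) =
        ((c + 1) • ((x.val : GL (Fin 3) (LocalRing L v)).val : Matrix (Fin 3) (Fin 3) (LocalRing L v)) + (c - 1) • 1) *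
          ((c - 1) • ((x.val : GL (Fin 3) (LocalRing L v)).val : Matrix (Fin 3) (Fin 3) (LocalRing L v)) + (c + 1) • 1)⁻¹ →
      F (ConjClasses.mk x) = F' (ConjClasses.mk y)) :
    (∑ᶠ cG : ConjClasses ((cmDatum L 3 H').Local v),
        ((finExplicitCollection L H' μ (finExplicitDelta_conj_left_all L H' μ) (finExplicitDelta_conj_right_all L H' μ)) v).Δ γH (Quotient.out cG) * F cG) =
      (((Ideal.absNorm v.asIdeal : ℕ) : ℂ) ^ 2)⁻¹ *
        (∑ᶠ cG : ConjClasses ((cmDatum L 3 H').Local v),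
          ((finExplicitCollection L H' μ (finExplicitDelta_conj_left_all L H' μ) (finExplicitDelta_conj_right_all L H' μ)) v).Δ uH (Quotient.out cG) * F' cG) :=
  finsum_finExplicitDelta_mul_eq_inv_sq_mul_finsum_shift L v H' w hw c γH uH μ hμω hunr hμ hσc h4c hreg hreg' h1 h2 hD1 hD2 hD hN hμ₂ hm F F' hF

end Literature.NumberTheory.Rogawski1990

end
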